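/-
Copyright (c) 2026 the pub-hodgecm-mathlib formalisation cell (harness21).  Prover seat hodgecm-mathlib-LH4-p04 (g8), req620 Track A «(D-RAM) FOUR-FRAME» squad
(STAGE-1b, row (2), the (β₂) road; heir LEAD F0P3a-plan (g21) T20-18 (R-36) «PURE-CELL LEDGER»; β₂-BOARD v1 (da0f832c) rows (L-cur)∕(L-soc), brick (S4-cells-B) part 1), 2026-09-04.
-/
import Summits.HodgeConjecture.HodgeConjecture.Theorems.F0P3cDyRamLabelledCensusCells        -- ★-cand (this seat): (S4-cells-A) `transvPlus_sub_cleanMinus_block_eq_cells` (datum-free cell currency)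
import Summits.HodgeConjecture.HodgeConjecture.Theorems.F0P3cDyRamLabelledFixCountBlockSeam   -- ★ p861163 (this seat): `transvPlusFixCount_eq_ncard_block`, `cleanMinusFixCount_eq_ncard_block`, `…_conj_eq_ncard_block`
import Summits.HodgeConjecture.HodgeConjecture.Theorems.F0P3cDyRamBlockCensusOrderFormCM       -- ★ (LH4-p11 (g5)): the (C1)-at-the-CM-place template; brings ★ Prelude `setOf_typeZero_fixed_eq_setOf_isSelfDualLattice_block`,
                                                                                               --   ★ `placeForm_antidiagOne`, ★ `conj_mem_unitaryGroupOfForm_iff`, ★ `isPrincipalIdealRing_integer_adicCompletion`, ★ `isUnit_det_placeForm` …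
import HarnessLib

/-!
# Crux `H413`, line LH4 «(D-RAM) FOUR-FRAME» — STAGE-1b, row (2), the (β₂) road, brick (S4-cells-B) part 1: «THE CELL CURRENCY AT THE CM PLACE, IN THE TWO LITERAL SHAPES» —
# `T₊ − T−′` of `ι_w(γ_H) = endoGL (γ₂, u)` (hyperbolic) and of `P₁·endoGL (γ₁, u)·P₁⁻¹` (anisotropic, `ᵗσ(P₁) Φ₃ P₁ = block(diag dg, η)`) as Σ over cells (j, b) of `cellDiff`

Cell `hodgecm-mathlib` (D-0151), FLOOR 0, crux item H413 = `stmt-HodgeConjecture-24833`, route of record `HCCMUnconditional`; squad F0∕P3c∕LH4; lane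
`--supports stmt-HodgeConjecture-24833 --as helper` (count-neutral; pays NO tier-0 row).  THEOREMS ONLY (no `def`, no instance, no notation, no `sorry`, default heartbeats).
Place data CONCRETE (`L_w`, `σ_w`, `ϖ`), the line-model field `M`, `jE`, `ρ`, `Θ`, `α` ABSTRACT (the producers' `(E′_{w₁}, toPlace, c_{w₁}, Θ, α)`), exactly as in ★ (LH4-p11 (g5))
`F0P3cDyRamBlockCensusOrderFormCM` (the unlabelled twin, whose binders are copied VERBATIM and followed by `(d) (hum)`).

WHAT IS PROVED (β₂-BOARD v1 §0, the CELL CURRENCY at the place).  For the record's indices `(ℓ, m*, m_c) = (d % 2, mstarOfRecord d, mcOfRecord d)` and reference set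
`V₊(d) = valueSetMod σ_w ϖ m* (xPlus σ_w ϖ d)`, near `1` (`hum : |u₀₀ − 1| ≤ |ϖ^{m*}|`):
* §1 `transvPlus_sub_cleanMinus_endoGL_eq_cells` — hyperbolic shape: `(T₊ − T−′)(endoGL (γ₂, u)) = Σ_{j<J+1} [lam ∈ 𝒪_j]·cellDiff(j,0) + Σ_{b∈[1,R]} Σ_j [lam ∈ 𝒪_j]·cellDiff(j,b)`
  with the cells of ★-cand (S4-cells-A) at `(H₂, h_W) := ((Φ₂)_w = (StdForm.antidiagonal 2).over L_w, 1)` (★ p861163 seam `…_eq_ncard_block` ∘ ★ Prelude ∘ ★ (S4-cells-A) §3);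
* §2 `transvPlus_sub_cleanMinus_conj_endoGL_eq_cells` — anisotropic shape: the same for `P₁·endoGL (γ₁, u)·P₁⁻¹` with cells at `(H₂, h_W) := (Matrix.diagonal dg, η)` (★ p861163 seam
  `…_conj_eq_ncard_block` at `hA := hfc ∘ ★ placeForm_antidiagThree`, ∘ ★ (S4-cells-A) §3; block unitarity by ★ `conj_mem_unitaryGroupOfForm_iff`).
These are the two literal tokens of `beta2Models.letter.v1` (46d52237) READ IN CELLS; part 2 (`hbeta2Models_of_ledger`, row (L-soc)) shrinks `V` for `hum` and does the arithmetic.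
HONEST LABEL.  Count-neutral lattice bookkeeping; nothing printed is asserted; no census law is stated; (β₂) and its letters stay HYPOTHESES; `HC_CM` is proved only modulo the
7 printed citations (2 remaining named inputs: hLiu418 = `stmt-HodgeConjecture-24832`, h413 = `stmt-HodgeConjecture-24833`) until rung 0 closes.
## References
* [Kottwitz1986BaseChangeUnits] R. E. Kottwitz, *Base change for unit elements of Hecke algebras*, Compositio Math. 60 (1986), §1 pp. 240–241.
* [Rogawski1990] J. D. Rogawski, *Automorphic Representations of Unitary Groups in Three Variables*, Ann. of Math. Stud. 123 (1990), §4.3 p. 43; §4.9 Prop. 4.9.1 (b) p. 55, Lemma 4.9.3 p. 56.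
* [Jacobowitz1962] R. Jacobowitz, *Hermitian forms over local fields*, Amer. J. Math. 84 (1962), §4.
* [BruhatTits1972] F. Bruhat, J. Tits, *Groupes réductifs sur un corps local I*, Publ. Math. IHÉS 41 (1972), §10.
-/

set_option autoImplicit false

noncomputable section

namespace Summit.HodgeConjecture.HodgeConjecture.Cruxes.H413.F0P3cDyRamLabelledCensusCellsCM

open MeasureTheory Measure NumberField IsDedekindDomain Topology Filter
open Literature.NumberTheory.Automorphic Literature.NumberTheory.Automorphic.UnitaryGroup Literature.NumberTheory.Automorphic.IntegralReduction
open Literature.NumberTheory.Rogawski1990 Literature.NumberTheory.GaloisRepresentations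
open Literature.NumberTheory.Automorphic.UnitaryThreeFourFrame
open scoped Matrix MatrixGroups Classical Valued WithZero
open Literature.NumberTheory.Automorphic.UnitaryLatticeTree Literature.NumberTheory.Automorphic.HermitianLattice
open Literature.NumberTheory.Automorphic.EllipticPlaneAsFieldLine
open Literature.NumberTheory.LocalFields.QuadraticOrder
open Summit.HodgeConjecture.HodgeConjecture.Cruxes.H413.F0P3cDyRamToricCensusDefs
open Summit.HodgeConjecture.HodgeConjecture.Cruxes.H413.F0P3cDyRamFourFramePieces
open Summit.HodgeConjecture.HodgeConjecture.Cruxes.H413.F0P3cDyRamFourFrameCensusDefs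
open Summit.HodgeConjecture.HodgeConjecture.Cruxes.H413.F0P3cDyRamStageOneBDefs
open Summit.HodgeConjecture.HodgeConjecture.Cruxes.H413.F0P3cDyRamFixedPointCensusTypeTwoPrelude
open Summit.HodgeConjecture.HodgeConjecture.Cruxes.H413.F0P3cDyRamLabelledFixCountBlockSeam
open Summit.HodgeConjecture.HodgeConjecture.Cruxes.H413.F0P3cDyRamLabelledCensusCells
open Summit.HodgeConjecture.HodgeConjecture.Cruxes.H413

/-! ## §1 The hyperbolic literal: `Γ = endoGL (γ₂, u)` for `Φ₃ = block(Φ₂, 1)` -/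

/-- **THE CELL CURRENCY AT THE CM PLACE, HYPERBOLIC SHAPE.**  For `Γ = endoGL (γ₂, u) ∈ U(σ_w, (Φ₃)_w)` and a line model `(M, jE, ρ, Θ, α; φ, lam, h)` of the plane
`((Φ₂)_w, γ₂)`, under ★ (C1)'s antecedents (binders of ★ `ncard_typeZero_fixed_endoGL_eq_orderForm` VERBATIM) plus `(d) (hum : |u₀₀ − 1| ≤ |ϖ^{m*}|)`:
`T₊(Γ) − T−′(Γ) = Σ_{j<J+1} [lam ∈ 𝒪_j]·(#cell₀⁺(j) − #cell₀⁻(j)) + Σ_{b∈[1,R]} Σ_j [lam ∈ 𝒪_j]·(Σᶠ_{cell_b⁺(j)} f − Σᶠ_{cell_b⁻(j)} f)` with ★-cand (S4-cells-A)'s labels at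
`(H₂, h_W) := ((StdForm.antidiagonal 2).over L_w, 1)`. [cite: Kottwitz1986BaseChangeUnits, §1 pp. 240–241] [cite: Rogawski1990, §4.3 p. 43; §4.9 Prop. 4.9.1 (b) p. 55] [cite: Jacobowitz1962, §4] [cite: BruhatTits1972, §10] -/
theorem transvPlus_sub_cleanMinus_endoGL_eq_cells (L : Type) [Field L] [NumberField L] [IsCMField L]
    {v : HeightOneSpectrum (𝓞 ↥(maximalRealSubfield L))} (w : UnitaryGroup.PlacesOver L v)
    (hw : IsCMField.complexConj L • w.1 = w.1) {ϖ : (w.1.adicCompletion L)} (hϖ : Valued.v ϖ = WithZero.exp (-1 : ℤ))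
    {M : Type*} [Field M] [Valued M ℤᵐ⁰] {ρ Θ : M →+* M} {α : M} (jE : (w.1.adicCompletion L) →+* M)
    (hρρ : ∀ x, ρ (ρ x) = x) (hvρ : ∀ x, Valued.v (ρ x) = Valued.v x) (hα : ρ α ≠ α) (hα1 : Valued.v α ≤ 1)
    (hint : ∀ z : M, Valued.v z ≤ 1 → Valued.v ((z - ρ z) / (α - ρ α)) ≤ 1)
    (hΘΘ : ∀ x, Θ (Θ x) = x) (hΘρ : ∀ x, Θ (ρ x) = ρ (Θ x)) (hvΘ : ∀ x, Valued.v (Θ x) = Valued.v x)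
    (hΘj : ∀ x, Θ (jE x) = jE ((galAdicCompletionMap (L := L) (IsCMField.complexConj L) hw) x))
    (hjv : ∀ c, Valued.v (jE c) ≤ 1 ↔ Valued.v c ≤ 1) (hjfix : ∀ z, ρ z = z ↔ ∃ c, jE c = z)
    (hjpow : ∀ (t : (w.1.adicCompletion L)) (n : ℤ), Valued.v (jE t) = Valued.v (jE ϖ) ^ n ↔ Valued.v t = Valued.v ϖ ^ n)
    (hEval : ∀ c : M, ρ c = c → c ≠ 0 → Valued.v c ≤ 1 → ∃ n : ℕ, Valued.v c = Valued.v (jE ϖ) ^ n)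
    (hϖmax : ∀ t : M, ρ t = t → Valued.v t < 1 → Valued.v t ≤ Valued.v (jE ϖ))
    (φ : (Fin 2 → (w.1.adicCompletion L)) →+ M) (hφs : ∀ (c : (w.1.adicCompletion L)) (x : Fin 2 → (w.1.adicCompletion L)), φ (c • x) = jE c * φ x)
    (hφi : Function.Injective φ) (hφo : Function.Surjective φ)
    (γ₂ : GL (Fin 2) (w.1.adicCompletion L)) {lam h : M} (hφγ : ∀ x, φ ((γ₂ : Matrix (Fin 2) (Fin 2) (w.1.adicCompletion L)).mulVec x) = lam * φ x) (hlam : Valued.v lam = 1)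
    (hΘh : Θ h = h) (hh : h ≠ 0)
    (hform : ∀ x y, jE (pairing (galAdicCompletionMap (L := L) (IsCMField.complexConj L) hw) (placeForm (Matrix.of fun i j : Fin 2 => if i.val + j.val + 1 = 2 then (1 : L) else 0) w.1) x y) =
      h * Θ (φ x) * φ y + ρ (h * Θ (φ x) * φ y))
    (u : GL (Fin 1) (w.1.adicCompletion L))
    (hΓ : endoGL (γ₂, u) ∈ unitaryGroupOfForm (galAdicCompletionMap (L := L) (IsCMField.complexConj L) hw) (placeForm (Matrix.of fun i j : Fin 3 => if i.val + j.val + 1 = 3 then (1 : L) else 0) w.1))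
    (hu : Valued.v ((u : Matrix (Fin 1) (Fin 1) (w.1.adicCompletion L)) 0 0) = 1) {R : ℕ}
    (hfinF : {M₃ : Submodule (Valued.integer (w.1.adicCompletion L)) (Fin 3 → (w.1.adicCompletion L)) |
      IsVertexLattice (galAdicCompletionMap (L := L) (IsCMField.complexConj L) hw) ϖ ((StdForm.antidiagonal 3).over (w.1.adicCompletion L)) 0 M₃ ∧ mapGL (endoGL (γ₂, u)) M₃ = M₃}.Finite)
    (hR : ∀ M₃ : Submodule (Valued.integer (w.1.adicCompletion L)) (Fin 3 → (w.1.adicCompletion L)),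
      IsVertexLattice (galAdicCompletionMap (L := L) (IsCMField.complexConj L) hw) ϖ ((StdForm.antidiagonal 3).over (w.1.adicCompletion L)) 0 M₃ →
      mapGL (endoGL (γ₂, u)) M₃ = M₃ → ∀ b : ℕ, (∀ c : (w.1.adicCompletion L), (Pi.single 1 c : Fin 3 → (w.1.adicCompletion L)) ∈ M₃ ↔ Valued.v c ≤ Valued.v ϖ ^ b) → b ≤ R)
    {J : ℕ} (hJ : ¬ IsOrd ρ α (jE ϖ ^ (J + 1)) lam) (hfinLS : ∀ j a, (levelSet ρ Θ α (jE ϖ) h j a).Finite)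
    (f : ℕ → ℕ → AddSubgroup M → ℕ)
    (hf : ∀ (b j : ℕ) (Λ : AddSubgroup M) (x₀ : M) (r : (w.1.adicCompletion L)), 1 ≤ b → x₀ ≠ 0 →
      (∀ x, x ∈ Λ ↔ ∃ z, IsOrd ρ α (jE ϖ ^ j) z ∧ x = x₀ * z) →
      IsOrd ρ α (jE ϖ ^ j) (dualGen ρ Θ α (jE ϖ ^ j) h x₀) → ¬ IsOrd ρ α (jE ϖ ^ j) (dualGen ρ Θ α (jE ϖ ^ j) h x₀ / jE ϖ) →
      Valued.v (dualGen ρ Θ α (jE ϖ ^ j) h x₀) = Valued.v (jE ϖ) ^ b →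
      (∀ b', (∀ x ∈ Λ, Valued.v (h * Θ x * b' + ρ (h * Θ x * b')) ≤ 1) → (lam - jE ((u : Matrix (Fin 1) (Fin 1) (w.1.adicCompletion L)) 0 0)) * b' ∈ Λ) →
      IsOrd ρ α (jE ϖ ^ j) lam → jE r = glueUnit ρ Θ α (jE ϖ ^ j) h (jE ϖ) (jE 1) x₀ b →
      f b j Λ = Nat.card {x : 𝒪[(w.1.adicCompletion L)] ⧸ 𝓂[(w.1.adicCompletion L)] ^ (2 * b) //
        ∃ u' : 𝒪[(w.1.adicCompletion L)], Ideal.Quotient.mk (𝓂[(w.1.adicCompletion L)] ^ (2 * b)) u' = x ∧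
          Valued.v ((u' : (w.1.adicCompletion L)) * (galAdicCompletionMap (L := L) (IsCMField.complexConj L) hw) u' - r) ≤ Valued.v (ϖ ^ (2 * b))})
    (d : ℕ) (hum : Valued.v (((u : Matrix (Fin 1) (Fin 1) (w.1.adicCompletion L)) 0 0) - 1) ≤ Valued.v (ϖ ^ (mstarOfRecord d))) :
    (transvPlusFixCount (galAdicCompletionMap (L := L) (IsCMField.complexConj L) hw) ϖ d (d % 2) (mstarOfRecord d) (endoGL (γ₂, u)) : ℤ) -
        (cleanMinusFixCount (galAdicCompletionMap (L := L) (IsCMField.complexConj L) hw) ϖ d (d % 2) (mstarOfRecord d) (mcOfRecord d) (endoGL (γ₂, u)) : ℤ) =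
      (∑ j ∈ Finset.range (J + 1), (if IsOrd ρ α (jE ϖ ^ j) lam then
          ((levelSet ρ Θ α (jE ϖ) h j 0 ∩ {Λ | ∃ g₂ : GL (Fin 2) (w.1.adicCompletion L), (latt (g₂ : Matrix (Fin 2) (Fin 2) (w.1.adicCompletion L))).toAddSubgroup.map φ = Λ ∧
              (LatticeNearTransvShell ϖ (d % 2) (mstarOfRecord d) ((((endoGL (γ₂, u) : GL (Fin 3) (w.1.adicCompletion L)) : Matrix (Fin 3) (Fin 3) (w.1.adicCompletion L)) - 1)) (latt ((endoGL (g₂, (1 : GL (Fin 1) (w.1.adicCompletion L))) : GL (Fin 3) (w.1.adicCompletion L)) : Matrix (Fin 3) (Fin 3) (w.1.adicCompletion L))) ∧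
                {z : (w.1.adicCompletion L) | ∃ y ∈ latt ((endoGL (g₂, (1 : GL (Fin 1) (w.1.adicCompletion L))) : GL (Fin 3) (w.1.adicCompletion L)) : Matrix (Fin 3) (Fin 3) (w.1.adicCompletion L)), Valued.v ((ϖ ^ (mstarOfRecord d))⁻¹ * (z - pairing (galAdicCompletionMap (L := L) (IsCMField.complexConj L) hw) (!![((StdForm.antidiagonal 2).over (w.1.adicCompletion L)) 0 0, 0, ((StdForm.antidiagonal 2).over (w.1.adicCompletion L)) 0 1; 0, (1 : (w.1.adicCompletion L)), 0; ((StdForm.antidiagonal 2).over (w.1.adicCompletion L)) 1 0, 0, ((StdForm.antidiagonal 2).over (w.1.adicCompletion L)) 1 1] : Matrix (Fin 3) (Fin 3) (w.1.adicCompletion L)) y (((((endoGL (γ₂, u) : GL (Fin 3) (w.1.adicCompletion L)) : Matrix (Fin 3) (Fin 3) (w.1.adicCompletion L)) - 1)) *ᵥ y))) ≤ 1} =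
                  valueSetMod (galAdicCompletionMap (L := L) (IsCMField.complexConj L) hw) ϖ (mstarOfRecord d) (xPlus (galAdicCompletionMap (L := L) (IsCMField.complexConj L) hw) ϖ d))}).ncard : ℤ) -
            ((levelSet ρ Θ α (jE ϖ) h j 0 ∩ {Λ | ∃ g₂ : GL (Fin 2) (w.1.adicCompletion L), (latt (g₂ : Matrix (Fin 2) (Fin 2) (w.1.adicCompletion L))).toAddSubgroup.map φ = Λ ∧
              (LatticeNearTransvShell ϖ (d % 2) (mcOfRecord d) ((((endoGL (γ₂, u) : GL (Fin 3) (w.1.adicCompletion L)) : Matrix (Fin 3) (Fin 3) (w.1.adicCompletion L)) - 1)) (latt ((endoGL (g₂, (1 : GL (Fin 1) (w.1.adicCompletion L))) : GL (Fin 3) (w.1.adicCompletion L)) : Matrix (Fin 3) (Fin 3) (w.1.adicCompletion L))) ∧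
                ¬ {z : (w.1.adicCompletion L) | ∃ y ∈ latt ((endoGL (g₂, (1 : GL (Fin 1) (w.1.adicCompletion L))) : GL (Fin 3) (w.1.adicCompletion L)) : Matrix (Fin 3) (Fin 3) (w.1.adicCompletion L)), Valued.v ((ϖ ^ (mstarOfRecord d))⁻¹ * (z - pairing (galAdicCompletionMap (L := L) (IsCMField.complexConj L) hw) (!![((StdForm.antidiagonal 2).over (w.1.adicCompletion L)) 0 0, 0, ((StdForm.antidiagonal 2).over (w.1.adicCompletion L)) 0 1; 0, (1 : (w.1.adicCompletion L)), 0; ((StdForm.antidiagonal 2).over (w.1.adicCompletion L)) 1 0, 0, ((StdForm.antidiagonal 2).over (w.1.adicCompletion L)) 1 1] : Matrix (Fin 3) (Fin 3) (w.1.adicCompletion L)) y (((((endoGL (γ₂, u) : GL (Fin 3) (w.1.adicCompletion L)) : Matrix (Fin 3) (Fin 3) (w.1.adicCompletion L)) - 1)) *ᵥ y))) ≤ 1} =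
                  valueSetMod (galAdicCompletionMap (L := L) (IsCMField.complexConj L) hw) ϖ (mstarOfRecord d) (xPlus (galAdicCompletionMap (L := L) (IsCMField.complexConj L) hw) ϖ d))}).ncard : ℤ) else 0)) +
        ∑ b ∈ Finset.Icc 1 R, ∑ j ∈ Finset.range (J + 1), (if IsOrd ρ α (jE ϖ ^ j) lam then
            ((∑ᶠ Λ ∈ levelSetDep ρ Θ α (jE ϖ) h j b (lam - jE ((u : Matrix (Fin 1) (Fin 1) (w.1.adicCompletion L)) 0 0)) ∩
                  {Λ | ∃ B : Submodule 𝒪[(w.1.adicCompletion L)] (Fin 2 → (w.1.adicCompletion L)), B.toAddSubgroup.map φ = Λ ∧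
                    ∃ L₃ : Submodule 𝒪[(w.1.adicCompletion L)] (Fin 3 → (w.1.adicCompletion L)), IsSelfDualLattice (galAdicCompletionMap (L := L) (IsCMField.complexConj L) hw) ϖ (!![((StdForm.antidiagonal 2).over (w.1.adicCompletion L)) 0 0, 0, ((StdForm.antidiagonal 2).over (w.1.adicCompletion L)) 0 1; 0, (1 : (w.1.adicCompletion L)), 0; ((StdForm.antidiagonal 2).over (w.1.adicCompletion L)) 1 0, 0, ((StdForm.antidiagonal 2).over (w.1.adicCompletion L)) 1 1] : Matrix (Fin 3) (Fin 3) (w.1.adicCompletion L)) L₃ ∧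
                      L₃ ⊓ LinearMap.ker ((LinearMap.proj (1 : Fin 3) : (Fin 3 → (w.1.adicCompletion L)) →ₗ[(w.1.adicCompletion L)] (w.1.adicCompletion L)).restrictScalars 𝒪[(w.1.adicCompletion L)]) =
                        B.map ((Matrix.toLin' (!![1, 0; 0, 0; 0, 1] : Matrix (Fin 3) (Fin 2) (w.1.adicCompletion L))).restrictScalars 𝒪[(w.1.adicCompletion L)]) ∧
                      (∀ c : (w.1.adicCompletion L), (Pi.single 1 c : Fin 3 → (w.1.adicCompletion L)) ∈ L₃ ↔ Valued.v c ≤ Valued.v ϖ ^ b) ∧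
                      (LatticeNearTransvShell ϖ (d % 2) (mstarOfRecord d) ((((endoGL (γ₂, u) : GL (Fin 3) (w.1.adicCompletion L)) : Matrix (Fin 3) (Fin 3) (w.1.adicCompletion L)) - 1)) L₃ ∧
                        {z : (w.1.adicCompletion L) | ∃ y ∈ L₃, Valued.v ((ϖ ^ (mstarOfRecord d))⁻¹ * (z - pairing (galAdicCompletionMap (L := L) (IsCMField.complexConj L) hw) (!![((StdForm.antidiagonal 2).over (w.1.adicCompletion L)) 0 0, 0, ((StdForm.antidiagonal 2).over (w.1.adicCompletion L)) 0 1; 0, (1 : (w.1.adicCompletion L)), 0; ((StdForm.antidiagonal 2).over (w.1.adicCompletion L)) 1 0, 0, ((StdForm.antidiagonal 2).over (w.1.adicCompletion L)) 1 1] : Matrix (Fin 3) (Fin 3) (w.1.adicCompletion L)) y (((((endoGL (γ₂, u) : GL (Fin 3) (w.1.adicCompletion L)) : Matrix (Fin 3) (Fin 3) (w.1.adicCompletion L)) - 1)) *ᵥ y))) ≤ 1} =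
                          valueSetMod (galAdicCompletionMap (L := L) (IsCMField.complexConj L) hw) ϖ (mstarOfRecord d) (xPlus (galAdicCompletionMap (L := L) (IsCMField.complexConj L) hw) ϖ d))}, f b j Λ : ℕ) : ℤ) -
              ((∑ᶠ Λ ∈ levelSetDep ρ Θ α (jE ϖ) h j b (lam - jE ((u : Matrix (Fin 1) (Fin 1) (w.1.adicCompletion L)) 0 0)) ∩
                  {Λ | ∃ B : Submodule 𝒪[(w.1.adicCompletion L)] (Fin 2 → (w.1.adicCompletion L)), B.toAddSubgroup.map φ = Λ ∧
                    ∃ L₃ : Submodule 𝒪[(w.1.adicCompletion L)] (Fin 3 → (w.1.adicCompletion L)), IsSelfDualLattice (galAdicCompletionMap (L := L) (IsCMField.complexConj L) hw) ϖ (!![((StdForm.antidiagonal 2).over (w.1.adicCompletion L)) 0 0, 0, ((StdForm.antidiagonal 2).over (w.1.adicCompletion L)) 0 1; 0, (1 : (w.1.adicCompletion L)), 0; ((StdForm.antidiagonal 2).over (w.1.adicCompletion L)) 1 0, 0, ((StdForm.antidiagonal 2).over (w.1.adicCompletion L)) 1 1] : Matrix (Fin 3) (Fin 3) (w.1.adicCompletion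 L)) L₃ ∧
                      L₃ ⊓ LinearMap.ker ((LinearMap.proj (1 : Fin 3) : (Fin 3 → (w.1.adicCompletion L)) →ₗ[(w.1.adicCompletion L)] (w.1.adicCompletion L)).restrictScalars 𝒪[(w.1.adicCompletion L)]) =
                        B.map ((Matrix.toLin' (!![1, 0; 0, 0; 0, 1] : Matrix (Fin 3) (Fin 2) (w.1.adicCompletion L))).restrictScalars 𝒪[(w.1.adicCompletion L)]) ∧
                      (∀ c : (w.1.adicCompletion L), (Pi.single 1 c : Fin 3 → (w.1.adicCompletion L)) ∈ L₃ ↔ Valued.v c ≤ Valued.v ϖ ^ b) ∧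
                      (LatticeNearTransvShell ϖ (d % 2) (mcOfRecord d) ((((endoGL (γ₂, u) : GL (Fin 3) (w.1.adicCompletion L)) : Matrix (Fin 3) (Fin 3) (w.1.adicCompletion L)) - 1)) L₃ ∧
                        ¬ {z : (w.1.adicCompletion L) | ∃ y ∈ L₃, Valued.v ((ϖ ^ (mstarOfRecord d))⁻¹ * (z - pairing (galAdicCompletionMap (L := L) (IsCMField.complexConj L) hw) (!![((StdForm.antidiagonal 2).over (w.1.adicCompletion L)) 0 0, 0, ((StdForm.antidiagonal 2).over (w.1.adicCompletion L)) 0 1; 0, (1 : (w.1.adicCompletion L)), 0; ((StdForm.antidiagonal 2).over (w.1.adicCompletion L)) 1 0, 0, ((StdForm.antidiagonal 2).over (w.1.adicCompletion L)) 1 1] : Matrix (Fin 3) (Fin 3) (w.1.adicCompletion L)) y (((((endoGL (γ₂, u) : GL (Fin 3) (w.1.adicCompletion L)) : Matrix (Fin 3) (Fin 3) (w.1.adicCompletion L)) - 1)) *ᵥ y))) ≤ 1} =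
                          valueSetMod (galAdicCompletionMap (L := L) (IsCMField.complexConj L) hw) ϖ (mstarOfRecord d) (xPlus (galAdicCompletionMap (L := L) (IsCMField.complexConj L) hw) ϖ d))}, f b j Λ : ℕ) : ℤ) else 0) := by
  haveI : IsPrincipalIdealRing 𝒪[w.1.adicCompletion L] := isPrincipalIdealRing_integer_adicCompletion L v w
  have hσ : ∀ a, (galAdicCompletionMap (L := L) (IsCMField.complexConj L) hw) ((galAdicCompletionMap (L := L) (IsCMField.complexConj L) hw) a) = a :=
    galAdicCompletionMap_involutive L v w hw
  have hvσ : ∀ a, Valued.v ((galAdicCompletionMap (L := L) (IsCMField.complexConj L) hw) a) = Valued.v a :=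
    fun a => valued_galAdicCompletionMap (L := L) (IsCMField.complexConj L) hw a
  have hH₂ : IsUnit ((StdForm.antidiagonal 2).over (w.1.adicCompletion L)).det := by
    rw [← placeForm_antidiagOne]
    exact isUnit_det_placeForm L v w _ (isUnit_antidiagOne_det L 2).ne_zero
  have hH₂σ : (((StdForm.antidiagonal 2).over (w.1.adicCompletion L)).map (galAdicCompletionMap (L := L) (IsCMField.complexConj L) hw))ᵀ = ((StdForm.antidiagonal 2).over (w.1.adicCompletion L)) := by
    rw [← placeForm_antidiagOne]
    exact placeForm_map_transpose_of_hermitian L v w hw _ (antidiagOne_isHermitian L 2)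
  -- `Φ₃ = block(Φ₂, 1)` on the nose: the unitarity, the finiteness letters, the plane pairing
  have hblock : placeForm (Matrix.of fun i j : Fin 3 => if i.val + j.val + 1 = 3 then (1 : L) else 0) w.1 = (!![((StdForm.antidiagonal 2).over (w.1.adicCompletion L)) 0 0, 0, ((StdForm.antidiagonal 2).over (w.1.adicCompletion L)) 0 1; 0, (1 : (w.1.adicCompletion L)), 0; ((StdForm.antidiagonal 2).over (w.1.adicCompletion L)) 1 0, 0, ((StdForm.antidiagonal 2).over (w.1.adicCompletion L)) 1 1] : Matrix (Fin 3) (Fin 3) (w.1.adicCompletion L)) := by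
    rw [placeForm_antidiagOne, antidiagonal_three_over_eq_block_antidiagonal_two]
  rw [setOf_typeZero_fixed_eq_setOf_isSelfDualLattice_block L w hw ϖ, placeForm_antidiagOne] at hfinF
  rw [hblock] at hΓ
  rw [placeForm_antidiagOne] at hform
  have hR' : ∀ M₃ : Submodule (Valued.integer (w.1.adicCompletion L)) (Fin 3 → (w.1.adicCompletion L)),
      IsSelfDualLattice (galAdicCompletionMap (L := L) (IsCMField.complexConj L) hw) ϖ (!![((StdForm.antidiagonal 2).over (w.1.adicCompletion L)) 0 0, 0, ((StdForm.antidiagonal 2).over (w.1.adicCompletion L)) 0 1; 0, (1 : (w.1.adicCompletion L)), 0; ((StdForm.antidiagonal 2).over (w.1.adicCompletion L)) 1 0, 0, ((StdForm.antidiagonal 2).over (w.1.adicCompletion L)) 1 1] : Matrix (Fin 3) (Fin 3) (w.1.adicCompletion L)) M₃ →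
      mapGL (endoGL (γ₂, u)) M₃ = M₃ → ∀ b : ℕ, (∀ c : (w.1.adicCompletion L), (Pi.single 1 c : Fin 3 → (w.1.adicCompletion L)) ∈ M₃ ↔ Valued.v c ≤ Valued.v ϖ ^ b) → b ≤ R := by
    intro M₃ hM₃ hfix b hb
    have hmem : M₃ ∈ {M₃ : Submodule (Valued.integer (w.1.adicCompletion L)) (Fin 3 → (w.1.adicCompletion L)) |
        IsSelfDualLattice (galAdicCompletionMap (L := L) (IsCMField.complexConj L) hw) ϖ (!![((StdForm.antidiagonal 2).over (w.1.adicCompletion L)) 0 0, 0, ((StdForm.antidiagonal 2).over (w.1.adicCompletion L)) 0 1; 0, (1 : (w.1.adicCompletion L)), 0; ((StdForm.antidiagonal 2).over (w.1.adicCompletion L)) 1 0, 0, ((StdForm.antidiagonal 2).over (w.1.adicCompletion L)) 1 1] : Matrix (Fin 3) (Fin 3) (w.1.adicCompletion L)) M₃ ∧ mapGL (endoGL (γ₂, u)) M₃ = M₃} := ⟨hM₃, hfix⟩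
    rw [← placeForm_antidiagOne (E := L), ← setOf_typeZero_fixed_eq_setOf_isSelfDualLattice_block L w hw ϖ] at hmem
    exact hR M₃ hmem.1 hmem.2 b hb
  have hf' := hf
  simp only [map_one] at hf'
  -- ★ p861163 seam on both counts (as `congrArg`, not `rw`: the CM carrier's `whnf` budget), then ★-cand (S4-cells-A) §3
  have e₁ := congrArg (fun n : ℕ => (n : ℤ)) (transvPlusFixCount_eq_ncard_block (galAdicCompletionMap (L := L) (IsCMField.complexConj L) hw) ϖ d (d % 2) (mstarOfRecord d) (endoGL (γ₂, u)))
  have e₂ := congrArg (fun n : ℕ => (n : ℤ)) (cleanMinusFixCount_eq_ncard_block (galAdicCompletionMap (L := L) (IsCMField.complexConj L) hw) ϖ d (d % 2) (mstarOfRecord d) (mcOfRecord d) (endoGL (γ₂, u)))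
  have key := transvPlus_sub_cleanMinus_block_eq_cells (galAdicCompletionMap (L := L) (IsCMField.complexConj L) hw) hσ hvσ hϖ hH₂ hH₂σ
    (hW := (1 : w.1.adicCompletion L)) (by rw [map_one]) (map_one _) jE hρρ hvρ hα hα1 hint hΘΘ hΘρ hvΘ hΘj hjv hjfix hjpow hEval hϖmax φ hφs hφi hφo hφγ hlam hΘh hh hform
    u hΓ hu hfinF hR' hJ hfinLS f (by simpa only [map_one] using hf') (d % 2) (mstarOfRecord d) (mcOfRecord d) hum (valueSetMod (galAdicCompletionMap (L := L) (IsCMField.complexConj L) hw) ϖ (mstarOfRecord d) (xPlus (galAdicCompletionMap (L := L) (IsCMField.complexConj L) hw) ϖ d))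
  exact (congrArg₂ (· - ·) e₁ e₂).trans key

/-! ## §2 The anisotropic literal: `P₁·endoGL (γ₁, u)·P₁⁻¹` with `ᵗσ(P₁) Φ₃ P₁ = block(diag dg, η)` -/

/-- **THE CELL CURRENCY AT THE CM PLACE, ANISOTROPIC SHAPE.**  For `P₁·endoGL (γ₁, u)·P₁⁻¹ ∈ U(σ_w, (Φ₃)_w)` with the frame equation `formCongr σ_w P₁ (Φ₃)_w = block(diag dg, η)`
(socket (A′)'s letters `|dg i| = 1`, `σ_w dg = dg`, `|η| = 1`, `σ_w η = η`) and a line model `(M, jE, ρ, Θ, α; φ, lam, h)` of the plane `(Matrix.diagonal dg, γ₁)`, under ★ (C1)'s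
antecedents (binders of ★ `ncard_typeZero_fixed_conj_endoGL_eq_orderForm` VERBATIM) plus `(d) (hum)`: `T₊(P₁ΓP₁⁻¹) − T−′(P₁ΓP₁⁻¹) = Σ over the cells of `(block(diag dg, η), endoGL (γ₁, u))`
(★ p861163 `…_conj_eq_ncard_block` ∘ ★-cand (S4-cells-A) §3). [cite: Kottwitz1986BaseChangeUnits, §1 pp. 240–241] [cite: Rogawski1990, §4.9 Lemma 4.9.3 p. 56] [cite: Jacobowitz1962, §4] [cite: BruhatTits1972, §10] -/
theorem transvPlus_sub_cleanMinus_conj_endoGL_eq_cells (L : Type) [Field L] [NumberField L] [IsCMField L]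
    {v : HeightOneSpectrum (𝓞 ↥(maximalRealSubfield L))} (w : UnitaryGroup.PlacesOver L v)
    (hw : IsCMField.complexConj L • w.1 = w.1) {ϖ : (w.1.adicCompletion L)} (hϖ : Valued.v ϖ = WithZero.exp (-1 : ℤ))
    {M : Type*} [Field M] [Valued M ℤᵐ⁰] {ρ Θ : M →+* M} {α : M} (jE : (w.1.adicCompletion L) →+* M)
    (hρρ : ∀ x, ρ (ρ x) = x) (hvρ : ∀ x, Valued.v (ρ x) = Valued.v x) (hα : ρ α ≠ α) (hα1 : Valued.v α ≤ 1)
    (hint : ∀ z : M, Valued.v z ≤ 1 → Valued.v ((z - ρ z) / (α - ρ α)) ≤ 1)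
    (hΘΘ : ∀ x, Θ (Θ x) = x) (hΘρ : ∀ x, Θ (ρ x) = ρ (Θ x)) (hvΘ : ∀ x, Valued.v (Θ x) = Valued.v x)
    (hΘj : ∀ x, Θ (jE x) = jE ((galAdicCompletionMap (L := L) (IsCMField.complexConj L) hw) x))
    (hjv : ∀ c, Valued.v (jE c) ≤ 1 ↔ Valued.v c ≤ 1) (hjfix : ∀ z, ρ z = z ↔ ∃ c, jE c = z)
    (hjpow : ∀ (t : (w.1.adicCompletion L)) (n : ℤ), Valued.v (jE t) = Valued.v (jE ϖ) ^ n ↔ Valued.v t = Valued.v ϖ ^ n)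
    (hEval : ∀ c : M, ρ c = c → c ≠ 0 → Valued.v c ≤ 1 → ∃ n : ℕ, Valued.v c = Valued.v (jE ϖ) ^ n)
    (hϖmax : ∀ t : M, ρ t = t → Valued.v t < 1 → Valued.v t ≤ Valued.v (jE ϖ))
    (P₁ : GL (Fin 3) (w.1.adicCompletion L)) (dg : Fin 2 → (w.1.adicCompletion L)) (η : (w.1.adicCompletion L))
    (γ₁ : GL (Fin 2) (w.1.adicCompletion L)) (u : GL (Fin 1) (w.1.adicCompletion L))
    (hfc : formCongr (galAdicCompletionMap (L := L) (IsCMField.complexConj L) hw) P₁ (placeForm (Matrix.of fun i j : Fin 3 => if i.val + j.val + 1 = 3 then (1 : L) else 0) w.1) =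
      (!![(Matrix.diagonal dg) 0 0, 0, (Matrix.diagonal dg) 0 1; 0, η, 0; (Matrix.diagonal dg) 1 0, 0, (Matrix.diagonal dg) 1 1] : Matrix (Fin 3) (Fin 3) (w.1.adicCompletion L)))
    (hdg1 : ∀ i, Valued.v (dg i) = 1) (hdgσ : ∀ i, (galAdicCompletionMap (L := L) (IsCMField.complexConj L) hw) (dg i) = dg i)
    (hησ : (galAdicCompletionMap (L := L) (IsCMField.complexConj L) hw) η = η) (hη1 : Valued.v η = 1)
    (hmem : P₁ * endoGL (γ₁, u) * P₁⁻¹ ∈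
      unitaryGroupOfForm (galAdicCompletionMap (L := L) (IsCMField.complexConj L) hw) (placeForm (Matrix.of fun i j : Fin 3 => if i.val + j.val + 1 = 3 then (1 : L) else 0) w.1))
    (hu : Valued.v ((u : Matrix (Fin 1) (Fin 1) (w.1.adicCompletion L)) 0 0) = 1)
    (φ : (Fin 2 → (w.1.adicCompletion L)) →+ M) (hφs : ∀ (c : (w.1.adicCompletion L)) (x : Fin 2 → (w.1.adicCompletion L)), φ (c • x) = jE c * φ x)
    (hφi : Function.Injective φ) (hφo : Function.Surjective φ)
    {lam h : M} (hφγ : ∀ x, φ ((γ₁ : Matrix (Fin 2) (Fin 2) (w.1.adicCompletion L)).mulVec x) = lam * φ x) (hlam : Valued.v lam = 1)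
    (hΘh : Θ h = h) (hh : h ≠ 0)
    (hform : ∀ x y, jE (pairing (galAdicCompletionMap (L := L) (IsCMField.complexConj L) hw) (Matrix.diagonal dg) x y) = h * Θ (φ x) * φ y + ρ (h * Θ (φ x) * φ y))
    {R : ℕ}
    (hfinF : {M₃ : Submodule (Valued.integer (w.1.adicCompletion L)) (Fin 3 → (w.1.adicCompletion L)) |
      IsSelfDualLattice (galAdicCompletionMap (L := L) (IsCMField.complexConj L) hw) ϖ
        (!![(Matrix.diagonal dg) 0 0, 0, (Matrix.diagonal dg) 0 1; 0, η, 0; (Matrix.diagonal dg) 1 0, 0, (Matrix.diagonal dg) 1 1] : Matrix (Fin 3) (Fin 3) (w.1.adicCompletion L)) M₃ ∧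
      mapGL (endoGL (γ₁, u)) M₃ = M₃}.Finite)
    (hR : ∀ M₃ : Submodule (Valued.integer (w.1.adicCompletion L)) (Fin 3 → (w.1.adicCompletion L)),
      IsSelfDualLattice (galAdicCompletionMap (L := L) (IsCMField.complexConj L) hw) ϖ
        (!![(Matrix.diagonal dg) 0 0, 0, (Matrix.diagonal dg) 0 1; 0, η, 0; (Matrix.diagonal dg) 1 0, 0, (Matrix.diagonal dg) 1 1] : Matrix (Fin 3) (Fin 3) (w.1.adicCompletion L)) M₃ →
      mapGL (endoGL (γ₁, u)) M₃ = M₃ → ∀ b : ℕ, (∀ c : (w.1.adicCompletion L), (Pi.single 1 c : Fin 3 → (w.1.adicCompletion L)) ∈ M₃ ↔ Valued.v c ≤ Valued.v ϖ ^ b) → b ≤ R)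
    {J : ℕ} (hJ : ¬ IsOrd ρ α (jE ϖ ^ (J + 1)) lam) (hfinLS : ∀ j a, (levelSet ρ Θ α (jE ϖ) h j a).Finite)
    (f : ℕ → ℕ → AddSubgroup M → ℕ)
    (hf : ∀ (b j : ℕ) (Λ : AddSubgroup M) (x₀ : M) (r : (w.1.adicCompletion L)), 1 ≤ b → x₀ ≠ 0 →
      (∀ x, x ∈ Λ ↔ ∃ z, IsOrd ρ α (jE ϖ ^ j) z ∧ x = x₀ * z) →
      IsOrd ρ α (jE ϖ ^ j) (dualGen ρ Θ α (jE ϖ ^ j) h x₀) → ¬ IsOrd ρ α (jE ϖ ^ j) (dualGen ρ Θ α (jE ϖ ^ j) h x₀ / jE ϖ) →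
      Valued.v (dualGen ρ Θ α (jE ϖ ^ j) h x₀) = Valued.v (jE ϖ) ^ b →
      (∀ b', (∀ x ∈ Λ, Valued.v (h * Θ x * b' + ρ (h * Θ x * b')) ≤ 1) → (lam - jE ((u : Matrix (Fin 1) (Fin 1) (w.1.adicCompletion L)) 0 0)) * b' ∈ Λ) →
      IsOrd ρ α (jE ϖ ^ j) lam → jE r = glueUnit ρ Θ α (jE ϖ ^ j) h (jE ϖ) (jE η) x₀ b →
      f b j Λ = Nat.card {x : 𝒪[(w.1.adicCompletion L)] ⧸ 𝓂[(w.1.adicCompletion L)] ^ (2 * b) //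
        ∃ u' : 𝒪[(w.1.adicCompletion L)], Ideal.Quotient.mk (𝓂[(w.1.adicCompletion L)] ^ (2 * b)) u' = x ∧
          Valued.v ((u' : (w.1.adicCompletion L)) * (galAdicCompletionMap (L := L) (IsCMField.complexConj L) hw) u' - r) ≤ Valued.v (ϖ ^ (2 * b))})
    (d : ℕ) (hum : Valued.v (((u : Matrix (Fin 1) (Fin 1) (w.1.adicCompletion L)) 0 0) - 1) ≤ Valued.v (ϖ ^ (mstarOfRecord d))) :
    (transvPlusFixCount (galAdicCompletionMap (L := L) (IsCMField.complexConj L) hw) ϖ d (d % 2) (mstarOfRecord d) (P₁ * endoGL (γ₁, u) * P₁⁻¹) : ℤ) -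
        (cleanMinusFixCount (galAdicCompletionMap (L := L) (IsCMField.complexConj L) hw) ϖ d (d % 2) (mstarOfRecord d) (mcOfRecord d) (P₁ * endoGL (γ₁, u) * P₁⁻¹) : ℤ) =
      (∑ j ∈ Finset.range (J + 1), (if IsOrd ρ α (jE ϖ ^ j) lam then
          ((levelSet ρ Θ α (jE ϖ) h j 0 ∩ {Λ | ∃ g₂ : GL (Fin 2) (w.1.adicCompletion L), (latt (g₂ : Matrix (Fin 2) (Fin 2) (w.1.adicCompletion L))).toAddSubgroup.map φ = Λ ∧
              (LatticeNearTransvShell ϖ (d % 2) (mstarOfRecord d) ((((endoGL (γ₁, u) : GL (Fin 3) (w.1.adicCompletion L)) : Matrix (Fin 3) (Fin 3) (w.1.adicCompletion L)) - 1)) (latt ((endoGL (g₂, (1 : GL (Fin 1) (w.1.adicCompletion L))) : GL (Fin 3) (w.1.adicCompletion L)) : Matrix (Fin 3) (Fin 3) (w.1.adicCompletion L))) ∧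
                {z : (w.1.adicCompletion L) | ∃ y ∈ latt ((endoGL (g₂, (1 : GL (Fin 1) (w.1.adicCompletion L))) : GL (Fin 3) (w.1.adicCompletion L)) : Matrix (Fin 3) (Fin 3) (w.1.adicCompletion L)), Valued.v ((ϖ ^ (mstarOfRecord d))⁻¹ * (z - pairing (galAdicCompletionMap (L := L) (IsCMField.complexConj L) hw) (!![(Matrix.diagonal dg) 0 0, 0, (Matrix.diagonal dg) 0 1; 0, η, 0; (Matrix.diagonal dg) 1 0, 0, (Matrix.diagonal dg) 1 1] : Matrix (Fin 3) (Fin 3) (w.1.adicCompletion L)) y (((((endoGL (γ₁, u) : GL (Fin 3) (w.1.adicCompletion L)) : Matrix (Fin 3) (Fin 3) (w.1.adicCompletion L)) - 1)) *ᵥ y))) ≤ 1} =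
                  valueSetMod (galAdicCompletionMap (L := L) (IsCMField.complexConj L) hw) ϖ (mstarOfRecord d) (xPlus (galAdicCompletionMap (L := L) (IsCMField.complexConj L) hw) ϖ d))}).ncard : ℤ) -
            ((levelSet ρ Θ α (jE ϖ) h j 0 ∩ {Λ | ∃ g₂ : GL (Fin 2) (w.1.adicCompletion L), (latt (g₂ : Matrix (Fin 2) (Fin 2) (w.1.adicCompletion L))).toAddSubgroup.map φ = Λ ∧
              (LatticeNearTransvShell ϖ (d % 2) (mcOfRecord d) ((((endoGL (γ₁, u) : GL (Fin 3) (w.1.adicCompletion L)) : Matrix (Fin 3) (Fin 3) (w.1.adicCompletion L)) - 1)) (latt ((endoGL (g₂, (1 : GL (Fin 1) (w.1.adicCompletion L))) : GL (Fin 3) (w.1.adicCompletion L)) : Matrix (Fin 3) (Fin 3) (w.1.adicCompletion L))) ∧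
                ¬ {z : (w.1.adicCompletion L) | ∃ y ∈ latt ((endoGL (g₂, (1 : GL (Fin 1) (w.1.adicCompletion L))) : GL (Fin 3) (w.1.adicCompletion L)) : Matrix (Fin 3) (Fin 3) (w.1.adicCompletion L)), Valued.v ((ϖ ^ (mstarOfRecord d))⁻¹ * (z - pairing (galAdicCompletionMap (L := L) (IsCMField.complexConj L) hw) (!![(Matrix.diagonal dg) 0 0, 0, (Matrix.diagonal dg) 0 1; 0, η, 0; (Matrix.diagonal dg) 1 0, 0, (Matrix.diagonal dg) 1 1] : Matrix (Fin 3) (Fin 3) (w.1.adicCompletion L)) y (((((endoGL (γ₁, u) : GL (Fin 3) (w.1.adicCompletion L)) : Matrix (Fin 3) (Fin 3) (w.1.adicCompletion L)) - 1)) *ᵥ y))) ≤ 1} =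
                  valueSetMod (galAdicCompletionMap (L := L) (IsCMField.complexConj L) hw) ϖ (mstarOfRecord d) (xPlus (galAdicCompletionMap (L := L) (IsCMField.complexConj L) hw) ϖ d))}).ncard : ℤ) else 0)) +
        ∑ b ∈ Finset.Icc 1 R, ∑ j ∈ Finset.range (J + 1), (if IsOrd ρ α (jE ϖ ^ j) lam then
            ((∑ᶠ Λ ∈ levelSetDep ρ Θ α (jE ϖ) h j b (lam - jE ((u : Matrix (Fin 1) (Fin 1) (w.1.adicCompletion L)) 0 0)) ∩
                  {Λ | ∃ B : Submodule 𝒪[(w.1.adicCompletion L)] (Fin 2 → (w.1.adicCompletion L)), B.toAddSubgroup.map φ = Λ ∧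
                    ∃ L₃ : Submodule 𝒪[(w.1.adicCompletion L)] (Fin 3 → (w.1.adicCompletion L)), IsSelfDualLattice (galAdicCompletionMap (L := L) (IsCMField.complexConj L) hw) ϖ (!![(Matrix.diagonal dg) 0 0, 0, (Matrix.diagonal dg) 0 1; 0, η, 0; (Matrix.diagonal dg) 1 0, 0, (Matrix.diagonal dg) 1 1] : Matrix (Fin 3) (Fin 3) (w.1.adicCompletion L)) L₃ ∧
                      L₃ ⊓ LinearMap.ker ((LinearMap.proj (1 : Fin 3) : (Fin 3 → (w.1.adicCompletion L)) →ₗ[(w.1.adicCompletion L)] (w.1.adicCompletion L)).restrictScalars 𝒪[(w.1.adicCompletion L)]) =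
                        B.map ((Matrix.toLin' (!![1, 0; 0, 0; 0, 1] : Matrix (Fin 3) (Fin 2) (w.1.adicCompletion L))).restrictScalars 𝒪[(w.1.adicCompletion L)]) ∧
                      (∀ c : (w.1.adicCompletion L), (Pi.single 1 c : Fin 3 → (w.1.adicCompletion L)) ∈ L₃ ↔ Valued.v c ≤ Valued.v ϖ ^ b) ∧
                      (LatticeNearTransvShell ϖ (d % 2) (mstarOfRecord d) ((((endoGL (γ₁, u) : GL (Fin 3) (w.1.adicCompletion L)) : Matrix (Fin 3) (Fin 3) (w.1.adicCompletion L)) - 1)) L₃ ∧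
                        {z : (w.1.adicCompletion L) | ∃ y ∈ L₃, Valued.v ((ϖ ^ (mstarOfRecord d))⁻¹ * (z - pairing (galAdicCompletionMap (L := L) (IsCMField.complexConj L) hw) (!![(Matrix.diagonal dg) 0 0, 0, (Matrix.diagonal dg) 0 1; 0, η, 0; (Matrix.diagonal dg) 1 0, 0, (Matrix.diagonal dg) 1 1] : Matrix (Fin 3) (Fin 3) (w.1.adicCompletion L)) y (((((endoGL (γ₁, u) : GL (Fin 3) (w.1.adicCompletion L)) : Matrix (Fin 3) (Fin 3) (w.1.adicCompletion L)) - 1)) *ᵥ y))) ≤ 1} =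
                          valueSetMod (galAdicCompletionMap (L := L) (IsCMField.complexConj L) hw) ϖ (mstarOfRecord d) (xPlus (galAdicCompletionMap (L := L) (IsCMField.complexConj L) hw) ϖ d))}, f b j Λ : ℕ) : ℤ) -
              ((∑ᶠ Λ ∈ levelSetDep ρ Θ α (jE ϖ) h j b (lam - jE ((u : Matrix (Fin 1) (Fin 1) (w.1.adicCompletion L)) 0 0)) ∩
                  {Λ | ∃ B : Submodule 𝒪[(w.1.adicCompletion L)] (Fin 2 → (w.1.adicCompletion L)), B.toAddSubgroup.map φ = Λ ∧
                    ∃ L₃ : Submodule 𝒪[(w.1.adicCompletion L)] (Fin 3 → (w.1.adicCompletion L)), IsSelfDualLattice (galAdicCompletionMap (L := L) (IsCMField.complexConj L) hw) ϖ (!![(Matrix.diagonal dg) 0 0, 0, (Matrix.diagonal dg) 0 1; 0, η, 0; (Matrix.diagonal dg) 1 0, 0, (Matrix.diagonal dg) 1 1] : Matrix (Fin 3) (Fin 3) (w.1.adicCompletion L)) L₃ ∧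
                      L₃ ⊓ LinearMap.ker ((LinearMap.proj (1 : Fin 3) : (Fin 3 → (w.1.adicCompletion L)) →ₗ[(w.1.adicCompletion L)] (w.1.adicCompletion L)).restrictScalars 𝒪[(w.1.adicCompletion L)]) =
                        B.map ((Matrix.toLin' (!![1, 0; 0, 0; 0, 1] : Matrix (Fin 3) (Fin 2) (w.1.adicCompletion L))).restrictScalars 𝒪[(w.1.adicCompletion L)]) ∧
                      (∀ c : (w.1.adicCompletion L), (Pi.single 1 c : Fin 3 → (w.1.adicCompletion L)) ∈ L₃ ↔ Valued.v c ≤ Valued.v ϖ ^ b) ∧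
                      (LatticeNearTransvShell ϖ (d % 2) (mcOfRecord d) ((((endoGL (γ₁, u) : GL (Fin 3) (w.1.adicCompletion L)) : Matrix (Fin 3) (Fin 3) (w.1.adicCompletion L)) - 1)) L₃ ∧
                        ¬ {z : (w.1.adicCompletion L) | ∃ y ∈ L₃, Valued.v ((ϖ ^ (mstarOfRecord d))⁻¹ * (z - pairing (galAdicCompletionMap (L := L) (IsCMField.complexConj L) hw) (!![(Matrix.diagonal dg) 0 0, 0, (Matrix.diagonal dg) 0 1; 0, η, 0; (Matrix.diagonal dg) 1 0, 0, (Matrix.diagonal dg) 1 1] : Matrix (Fin 3) (Fin 3) (w.1.adicCompletion L)) y (((((endoGL (γ₁, u) : GL (Fin 3) (w.1.adicCompletion L)) : Matrix (Fin 3) (Fin 3) (w.1.adicCompletion L)) - 1)) *ᵥ y))) ≤ 1} =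
                          valueSetMod (galAdicCompletionMap (L := L) (IsCMField.complexConj L) hw) ϖ (mstarOfRecord d) (xPlus (galAdicCompletionMap (L := L) (IsCMField.complexConj L) hw) ϖ d))}, f b j Λ : ℕ) : ℤ) else 0) := by
  haveI : IsPrincipalIdealRing 𝒪[w.1.adicCompletion L] := isPrincipalIdealRing_integer_adicCompletion L v w
  have hσ : ∀ a, (galAdicCompletionMap (L := L) (IsCMField.complexConj L) hw) ((galAdicCompletionMap (L := L) (IsCMField.complexConj L) hw) a) = a :=
    galAdicCompletionMap_involutive L v w hw
  have hvσ : ∀ a, Valued.v ((galAdicCompletionMap (L := L) (IsCMField.complexConj L) hw) a) = Valued.v a :=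
    fun a => valued_galAdicCompletionMap (L := L) (IsCMField.complexConj L) hw a
  -- `diag dg` is hermitian of unit determinant
  have hH₂ : IsUnit (Matrix.diagonal dg).det := by
    rw [Matrix.det_diagonal]
    refine isUnit_iff_ne_zero.2 (Finset.prod_ne_zero_iff.2 fun i _ h0 => ?_)
    have h1 := hdg1 i
    rw [h0, map_zero] at h1
    exact zero_ne_one h1
  have hH₂σ : ((Matrix.diagonal dg).map (galAdicCompletionMap (L := L) (IsCMField.complexConj L) hw))ᵀ = Matrix.diagonal dg := by
    rw [Matrix.diagonal_map (map_zero _), Matrix.diagonal_transpose]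
    exact congrArg Matrix.diagonal (funext hdgσ)
  -- the frame equation over `(StdForm.antidiagonal 3).over`, and the block's unitarity for the congruent form
  have hA : formCongr (galAdicCompletionMap (L := L) (IsCMField.complexConj L) hw) P₁ ((StdForm.antidiagonal 3).over (w.1.adicCompletion L)) = (!![(Matrix.diagonal dg) 0 0, 0, (Matrix.diagonal dg) 0 1; 0, η, 0; (Matrix.diagonal dg) 1 0, 0, (Matrix.diagonal dg) 1 1] : Matrix (Fin 3) (Fin 3) (w.1.adicCompletion L)) := by
    rw [← placeForm_antidiagOne]; exact hfc
  have hΓ : endoGL (γ₁, u) ∈ unitaryGroupOfForm (galAdicCompletionMap (L := L) (IsCMField.complexConj L) hw) (!![(Matrix.diagonal dg) 0 0, 0, (Matrix.diagonal dg) 0 1; 0, η, 0; (Matrix.diagonal dg) 1 0, 0, (Matrix.diagonal dg) 1 1] : Matrix (Fin 3) (Fin 3) (w.1.adicCompletion L)) := by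
    rw [← hfc]
    exact (conj_mem_unitaryGroupOfForm_iff (galAdicCompletionMap (L := L) (IsCMField.complexConj L) hw) P₁ _ (endoGL (γ₁, u))).1 hmem
  -- ★ p861163 seam (anisotropic shape) on both counts, then ★-cand (S4-cells-A) §3 at `(H₂, h_W) := (diag dg, η)`
  have e₁ := congrArg (fun n : ℕ => (n : ℤ)) (transvPlusFixCount_conj_eq_ncard_block (galAdicCompletionMap (L := L) (IsCMField.complexConj L) hw) ϖ (T := endoGL (γ₁, u)) hA d (d % 2) (mstarOfRecord d))
  have e₂ := congrArg (fun n : ℕ => (n : ℤ)) (cleanMinusFixCount_conj_eq_ncard_block (galAdicCompletionMap (L := L) (IsCMField.complexConj L) hw) ϖ (T := endoGL (γ₁, u)) hA d (d % 2) (mstarOfRecord d) (mcOfRecord d))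
  refine (congrArg₂ (· - ·) e₁ e₂).trans ?_
  exact transvPlus_sub_cleanMinus_block_eq_cells (galAdicCompletionMap (L := L) (IsCMField.complexConj L) hw) hσ hvσ hϖ hH₂ hH₂σ hη1 hησ jE hρρ hvρ hα hα1 hint
    hΘΘ hΘρ hvΘ hΘj hjv hjfix hjpow hEval hϖmax φ hφs hφi hφo hφγ hlam hΘh hh hform u hΓ hu hfinF hR hJ hfinLS f hf (d % 2) (mstarOfRecord d) (mcOfRecord d) hum (valueSetMod (galAdicCompletionMap (L := L) (IsCMField.complexConj L) hw) ϖ (mstarOfRecord d) (xPlus (galAdicCompletionMap (L := L) (IsCMField.complexConj L) hw) ϖ d))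

end Summit.HodgeConjecture.HodgeConjecture.Cruxes.H413.F0P3cDyRamLabelledCensusCellsCM

end
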